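import Summits.ResolutionOfSingularities.ResolutionOfSingularities.Theorems.PowerLiftBridge

/-!
# PowerLiftTransport — slice 3/4 of decomp-res lens-5 g42 «PowerLift» (PIN `PowerLift.lean` sha256 1772eef3, 746 l), §4 the geometric vocabulary is marking-free (transport lemmas)
(monolith lines 357–528); sliced by the writer (g16) at the lens's own cut points for the ≤ 400-line rule (cn41) — declarations,
docstrings and proofs byte-verbatim; only this module docstring, the import of the previous slice and the repeated file header
(`noncomputable section`, `set_option linter.dupNamespace false`, the `open`s, the namespace) are added.  The mathematical
overview, sources and compliance notes are in the module docstring of slice 1 (`Theorems/PowerLift.lean`).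
-/

noncomputable section

set_option linter.dupNamespace false

open CategoryTheory CategoryTheory.Limits AlgebraicGeometry TopologicalSpace IsLocalRing
open Literature.AlgebraicGeometry.Resolution
open Summit.ResolutionOfSingularities.ResolutionOfSingularities.Theorems
open WeakOrderReduction ForcedTowerClasses DivergentTowerClasses MonomialTowerClasses
open HugDimensionClasses HugDimensionKernels SurfaceShadowClasses SurfaceShadowKernels

namespace Summit.ResolutionOfSingularities.ResolutionOfSingularities.Theorems.HugValuationCut

/-! ## §4 The geometric vocabulary is marking-free -/

section Transport

variable {T : ForcedTower} {a : ℕ} {hiso : ∀ i, IsIsolatedIn (powMarked (T.D i) a).support (T.pt i)}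
  {htr : ∀ i, powMarked (T.D (i + 1)) a = (powMarked (T.D i) a).transform (T.π i) (T.centre i)}

/-- own components and proximity read the boundary only. [folklore] -/
theorem proximate_powTower_iff (i j : ℕ) : Proximate (powTower T a hiso htr) i j ↔ Proximate T i j := Iff.rfl

/-- hugging of own components reads the boundary only. [folklore] -/
theorem hugs_powTower_iff (j : ℕ) : Hugs (powTower T a hiso htr) j ↔ Hugs T j := Iff.rfl

/-- iterated strict transforms read blow-ups and centres only. [folklore] -/
theorem strictIter_powTower (m : ℕ) (H : (T.St m).IdealSheafData) :
    ∀ j, strictIter (powTower T a hiso htr) m H j = strictIter T m H j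
  | 0 => rfl
  | j + 1 => by
    rw [strictIter, strictIter, strictIter_powTower m H j]
    rfl

/-- germ hugging reads points and strict transforms only. [folklore] -/
theorem hugsGerm_powTower_iff (m : ℕ) (H : (T.St m).IdealSheafData) :
    HugsGerm (powTower T a hiso htr) m H ↔ HugsGerm T m H := by
  unfold HugsGerm
  refine and_congr Iff.rfl (forall_congr' fun j => ?_)
  rw [strictIter_powTower m H j]
  exact Iff.rfl

/-- dimension-graded germ hugging is marking-free. [folklore] -/
theorem hugsGermOfDim_powTower_iff (w : ℕ) : HugsGermOfDim (powTower T a hiso htr) w ↔ HugsGermOfDim T w :=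
  exists_congr fun m => exists_congr fun H =>
    and_congr (hugsGerm_powTower_iff (T := T) (hiso := hiso) (htr := htr) m H) Iff.rfl

/-- curve hugging is marking-free. [folklore] -/
theorem curveHugging_powTower_iff : CurveHugging (powTower T a hiso htr) ↔ CurveHugging T :=
  hugsGermOfDim_powTower_iff 1

/-- surface hugging is marking-free. [folklore] -/
theorem surfaceHugging_powTower_iff : SurfaceHugging (powTower T a hiso htr) ↔ SurfaceHugging T :=
  hugsGermOfDim_powTower_iff 2

/-- germ hugging is marking-free. [folklore] -/
theorem germHugging_powTower_iff : GermHugging (powTower T a hiso htr) ↔ GermHugging T :=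
  exists_congr fun m => exists_congr fun H => hugsGerm_powTower_iff (T := T) (hiso := hiso) (htr := htr) m H

/-- **permanent contact is marking-free** (the contact column `h71`). [folklore] -/
theorem contactHugging_powTower_iff : ContactHugging (powTower T a hiso htr) ↔ ContactHugging T :=
  exists_congr fun m => exists_congr fun H =>
    and_congr Iff.rfl (hugsGerm_powTower_iff (T := T) (hiso := hiso) (htr := htr) m H)

/-- regular-surface hugging is marking-free. [folklore] -/
theorem regularSurfaceHugging_powTower_iff :
    RegularSurfaceHugging (powTower T a hiso htr) ↔ RegularSurfaceHugging T :=
  exists_congr fun m => exists_congr fun H =>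
    and_congr (hugsGerm_powTower_iff (T := T) (hiso := hiso) (htr := htr) m H) Iff.rfl

/-- the threefold letter reads the stalks only. [folklore] -/
theorem threefoldTower_powTower_iff : ThreefoldTower (powTower T a hiso htr) ↔ ThreefoldTower T := Iff.rfl

/-- `ContactHugging` is marking-invariant. [folklore] -/
theorem powInvariant_contactHugging : PowInvariant ContactHugging := fun _ _ _ _ => contactHugging_powTower_iff

/-- `GermHugging` is marking-invariant. [folklore] -/
theorem powInvariant_germHugging : PowInvariant GermHugging := fun _ _ _ _ => germHugging_powTower_iff

/-- `CurveHugging` is marking-invariant. [folklore] -/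
theorem powInvariant_curveHugging : PowInvariant CurveHugging := fun _ _ _ _ => curveHugging_powTower_iff

/-- `SurfaceHugging` is marking-invariant. [folklore] -/
theorem powInvariant_surfaceHugging : PowInvariant SurfaceHugging := fun _ _ _ _ => surfaceHugging_powTower_iff

/-- `RegularSurfaceHugging` is marking-invariant. [folklore] -/
theorem powInvariant_regularSurfaceHugging : PowInvariant RegularSurfaceHugging :=
  fun _ _ _ _ => regularSurfaceHugging_powTower_iff

/-- `ThreefoldTower` is marking-invariant. [folklore] -/
theorem powInvariant_threefoldTower : PowInvariant ThreefoldTower := fun _ _ _ _ => threefoldTower_powTower_iff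

/-- **hug shadows transport to the marking power** (field by field: the pin reads strict transforms, the dictionary
clauses read hugging letters). -/
def HugShadow.toPow (S : HugShadow T) (a : ℕ) (hiso : ∀ i, IsIsolatedIn (powMarked (T.D i) a).support (T.pt i))
    (htr : ∀ i, powMarked (T.D (i + 1)) a = (powMarked (T.D i) a).transform (T.π i) (T.centre i)) :
    HugShadow (powTower T a hiso htr) where
  m := S.m
  germ := S.germ
  hugs := (hugsGerm_powTower_iff S.m S.germ).mpr S.hugs
  dim_two := S.dim_two
  K := S.K
  instField := S.instField
  C := S.C
  stalkIso i := by
    rw [strictIter_powTower S.m S.germ i]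
    exact S.stalkIso i
  curve h := curveHugging_powTower_iff.mpr (S.curve h)
  regular h := regularSurfaceHugging_powTower_iff.mpr (S.regular h)

/-- **hug shadows of the marking power descend to the tower**. -/
def HugShadow.ofPow (S : HugShadow (powTower T a hiso htr)) : HugShadow T where
  m := S.m
  germ := S.germ
  hugs := (hugsGerm_powTower_iff (T := T) (hiso := hiso) (htr := htr) S.m S.germ).mp S.hugs
  dim_two := S.dim_two
  K := S.K
  instField := S.instField
  C := S.C
  stalkIso i := by
    rw [← strictIter_powTower (hiso := hiso) (htr := htr) S.m S.germ i]
    exact S.stalkIso i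
  curve h := curveHugging_powTower_iff.mp (S.curve h)
  regular h := regularSurfaceHugging_powTower_iff.mp (S.regular h)

/-- existence of hug shadows is marking-invariant. [folklore] -/
theorem nonempty_hugShadow_powTower_iff : Nonempty (HugShadow (powTower T a hiso htr)) ↔ Nonempty (HugShadow T) :=
  ⟨fun ⟨S⟩ => ⟨S.ofPow⟩, fun ⟨S⟩ => ⟨S.toPow a hiso htr⟩⟩

/-- **the germ ideal of a hug shadow is PRIME at the hugging point** — its quotient is pinned to the member `R 0` of the
shadow chain, a subring of a field. [folklore] -/
theorem HugShadow.isPrime_stalkIdeal_germ (S : HugShadow T) : (stalkIdeal S.germ (T.pt S.m)).IsPrime := by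
  obtain ⟨e⟩ := S.stalkIso 0
  haveI : IsDomain (((T.St S.m).presheaf.stalk (T.pt S.m)) ⧸ stalkIdeal S.germ (T.pt S.m)) :=
    MulEquiv.isDomain (S.C.R 0) e.symm.toMulEquiv
  exact (Ideal.Quotient.isDomain_iff_prime _).mp this

/-- **off-locus transports** (`𝓘^a ⊄ 𝔭 ⟺ 𝓘 ⊄ 𝔭` for the prime `𝔭`, `a ≥ 1`). [folklore] -/
theorem HugShadow.offLocus_toPow_iff (S : HugShadow T) (ha : 0 < a) :
    (S.toPow a hiso htr).OffLocus ↔ S.OffLocus := by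
  show ¬ stalkIdeal ((T.D S.m).ideal ^ a) (T.pt S.m) ≤ stalkIdeal S.germ (T.pt S.m) ↔
    ¬ stalkIdeal (T.D S.m).ideal (T.pt S.m) ≤ stalkIdeal S.germ (T.pt S.m)
  rw [stalkIdeal_pow]
  haveI := S.isPrime_stalkIdeal_germ
  exact not_congr (Ideal.IsPrime.pow_le_iff ha.ne')

/-- **off-locus descends** (`𝓘 ⊆ 𝔭 ⟹ 𝓘^a ⊆ 𝔭`, `a ≥ 1`). [folklore] -/
theorem HugShadow.offLocus_ofPow (S : HugShadow (powTower T a hiso htr)) (ha : 0 < a) (hS : S.OffLocus) :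
    S.ofPow.OffLocus := by
  intro hle
  apply hS
  show stalkIdeal ((T.D S.m).ideal ^ a) (T.pt S.m) ≤ stalkIdeal S.germ (T.pt S.m)
  rw [stalkIdeal_pow]
  exact (Ideal.pow_le_self ha.ne').trans hle

/-- **REWEIGHTING of marked sequences (pure field arithmetic)**: if `F` is a marked sequence of weight `(b+1)·n` over the
divider sequence `z`, then `f_i := F_i · (∏_{j<i} z_j)^{b·n}` is a marked sequence of weight `n` over `z`
(`f_{i+1} = F_i z_i^{-(b+1)n} (∏_{j≤i} z_j)^{bn} = f_i / z_i^n`; `f_i ∈ R_i` as `R_j ⊆ R_i`). [folklore] -/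
theorem HugChain.isMarkedSeq_reweight {K : Type} [Field K] (C : HugChain K) {b n : ℕ} {z F : ℕ → K}
    (hz : C.IsDividerSeq z) (hF : C.IsMarkedSeq ((b + 1) * n) z F) :
    C.IsMarkedSeq n z (fun i => F i * (∏ j ∈ Finset.range i, z j) ^ (b * n)) := by
  refine ⟨fun i => ⟨?_, ?_⟩, fun i => ?_⟩
  · exact mul_mem (hF.1 i).1 (pow_mem (prod_mem fun j hj =>
      C.mono (Finset.mem_range.mp hj).le (hz j).1) _)
  · exact mul_ne_zero (hF.1 i).2 (pow_ne_zero _ (Finset.prod_ne_zero_iff.mpr fun j _ => (hz j).2.1))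
  · have hz0 : z i ≠ 0 := (hz i).2.1
    have hP0 : (∏ j ∈ Finset.range i, z j) ≠ 0 := Finset.prod_ne_zero_iff.mpr fun j _ => (hz j).2.1
    simp only [Finset.prod_range_succ, mul_pow, hF.2 i]
    have hpow : z i ^ ((b + 1) * n) = z i ^ (b * n) * z i ^ n := by rw [← pow_add]; ring_nf
    rw [hpow]
    field_simp

/-- **marked shadows of weight `(b+1)·n` on `T^{b+1}` descend to marked shadows of weight `n` on `T`** (same shadow
and dividers, reweighted marked sequence). -/
def MarkedShadow.ofPow {b n : ℕ} {hiso : ∀ i, IsIsolatedIn (powMarked (T.D i) (b + 1)).support (T.pt i)}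
    {htr : ∀ i, powMarked (T.D (i + 1)) (b + 1) = (powMarked (T.D i) (b + 1)).transform (T.π i) (T.centre i)}
    (M : MarkedShadow (powTower T (b + 1) hiso htr) ((b + 1) * n)) : MarkedShadow T n where
  S := M.S.ofPow
  offLocus := M.S.offLocus_ofPow b.succ_pos M.offLocus
  z := M.z
  f i := M.f i * (∏ j ∈ Finset.range i, M.z j) ^ (b * n)
  divider := M.divider
  marked := M.S.C.isMarkedSeq_reweight M.divider M.marked

end Transport

end Summit.ResolutionOfSingularities.ResolutionOfSingularities.Theorems.HugValuationCut
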